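import Mathlib.Combinatorics.Matroid.Minor.Contract
import Mathlib.Combinatorics.Matroid.Rank.ENat
import HarnessLib

/-!
# Relative rank in a matroid

For a matroid `M` on `α` and sets `C X : Set α`, the **relative rank** `M.relRank C X` of `X`
over `C` is the rank of `X` in the contraction `M ／ C`; when all ranks are finite it is
`r(X ∪ C) - r(C)`, but it is meaningful (and finite for `X` finite) also when `r(C) = ∞`, which
is the situation of interest for the algebraic matroid of a big field over a subfield of infinite
transcendence degree (relative transcendence degree, used for Hrushovski predimensions in
`Literature/NumberTheory/Transcendental/GammaFields.lean`).

This file records the elementary calculus of relative rank (Oxley, *Matroid Theory*, §3.3 for the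
finite case; folklore in general): insensitivity to closures, monotonicity in `X`,
anti-monotonicity in `C` (= submodularity), the addition formula along `C ⊆ D ⊆ X`, finiteness
and the comparison with independence in the contraction.

## Design

`Matroid.relRank` and its lemmas are a deliberate dot-notation extension in Mathlib's namespace
`Matroid` (Mathlib at this pin has `Matroid.eRk` and contractions `M ／ C` but no relative rank),
so that one writes `M.relRank C X`.

## References

* J. Oxley, *Matroid Theory*, 2nd ed., OUP 2011, §3.3 (rank of contractions:
  `r_{M/C}(X) = r_M(X ∪ C) - r_M(C)`).
-/

open Set

namespace Matroid

variable {α : Type*} (M : Matroid α)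

/-- The **relative rank** of `X` over `C` in the matroid `M`: the rank of `X` in the contraction
`M ／ C` (for finite ranks, `r(X ∪ C) - r(C)`, Oxley §3.3). A deliberate dot-notation extension of
Mathlib's `Matroid` namespace. [folklore] -/
noncomputable def relRank (C X : Set α) : ℕ∞ :=
  (M ／ C).eRk X

variable {M} {C D X Y : Set α} {e : α}

/-- Unfolding lemma. [folklore] -/
theorem relRank_eq_eRk_contract (M : Matroid α) (C X : Set α) :
    M.relRank C X = (M ／ C).eRk X :=
  rfl

/-- Deleting loops (or non-elements) does not change ranks. [folklore] -/
theorem eRk_delete_eq_of_subset_loops {L : Set α} (hL : L ∩ M.E ⊆ M.loops) (X : Set α) :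
    (M ＼ L).eRk X = M.eRk X := by
  rw [delete_eq_restrict, restrict_eRk_eq', ← M.eRk_inter_ground X]
  have h1 : X ∩ (M.E \ L) = (X ∩ M.E) \ (L ∩ M.E) := by
    ext x; simp only [mem_inter_iff, mem_sdiff]; tauto
  rw [h1]
  exact M.eRk_eq_eRk_sdiff_eRk_le_zero _ (by
    rw [← M.eRk_loops]
    exact M.eRk_mono hL)

/-- Contraction can only lower ranks. [folklore] -/
theorem eRk_contract_le (M : Matroid α) (C X : Set α) : (M ／ C).eRk X ≤ M.eRk X := by
  obtain ⟨I, hI⟩ := (M ／ C).exists_isBasis' X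
  rw [← hI.encard_eq_eRk]
  exact hI.indep.of_contract.encard_le_eRk_of_subset hI.subset

/-- Relative rank only sees the part of `X` inside the ground set. [folklore] -/
theorem relRank_inter_ground (M : Matroid α) (C X : Set α) :
    M.relRank C (X ∩ M.E) = M.relRank C X := by
  rw [relRank, relRank, ← (M ／ C).eRk_inter_ground X, ← (M ／ C).eRk_inter_ground (X ∩ M.E),
    contract_ground, inter_assoc, inter_eq_self_of_subset_right sdiff_subset]

/-- Relative rank over `C` ignores `C` itself: `relRank C X = relRank C (X \ C)`. [folklore] -/
theorem relRank_eq_relRank_diff (M : Matroid α) (C X : Set α) :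
    M.relRank C X = M.relRank C (X \ C) := by
  rw [relRank, relRank, ← (M ／ C).eRk_inter_ground X, ← (M ／ C).eRk_inter_ground (X \ C),
    contract_ground]
  congr 1
  ext x; simp only [mem_inter_iff, mem_sdiff]; tauto

/-- `relRank C (X ∪ C) = relRank C X`. [folklore] -/
theorem relRank_union_self_right (M : Matroid α) (C X : Set α) :
    M.relRank C (X ∪ C) = M.relRank C X := by
  rw [relRank_eq_relRank_diff, union_sdiff_right, ← relRank_eq_relRank_diff]

/-- `relRank C (C ∪ X) = relRank C X`. [folklore] -/
theorem relRank_union_self_left (M : Matroid α) (C X : Set α) :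
    M.relRank C (C ∪ X) = M.relRank C X := by
  rw [union_comm, relRank_union_self_right]

/-- `relRank C C = 0`. [folklore] -/
@[simp] theorem relRank_self (M : Matroid α) (C : Set α) : M.relRank C C = 0 := by
  rw [relRank_eq_relRank_diff, sdiff_self, relRank, eRk_empty]

/-- `relRank C ∅ = 0`. [folklore] -/
@[simp] theorem relRank_empty (M : Matroid α) (C : Set α) : M.relRank C ∅ = 0 := by
  rw [relRank, eRk_empty]

/-- Relative rank is monotone in the set. [folklore] -/
theorem relRank_mono_right (M : Matroid α) (C : Set α) (h : X ⊆ Y) :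
    M.relRank C X ≤ M.relRank C Y :=
  (M ／ C).eRk_mono h

/-- Relative rank is bounded by the number of new elements. [folklore] -/
theorem relRank_le_encard_diff (M : Matroid α) (C X : Set α) :
    M.relRank C X ≤ (X \ C).encard := by
  rw [relRank_eq_relRank_diff]
  exact (M ／ C).eRk_le_encard _

/-- Relative rank over `C` of `C` plus finitely many elements is finite. [folklore] -/
theorem relRank_lt_top_of_finite (M : Matroid α) (C : Set α) (h : (X \ C).Finite) :
    M.relRank C X < ⊤ :=
  lt_of_le_of_lt (M.relRank_le_encard_diff C X) (h.encard_lt_top)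

/-- Relative rank is subadditive in the set. [folklore] -/
theorem relRank_union_le (M : Matroid α) (C X Y : Set α) :
    M.relRank C (X ∪ Y) ≤ M.relRank C X + M.relRank C Y :=
  (M ／ C).eRk_union_le_eRk_add_eRk X Y

/-- Adding one element raises the relative rank by at most one. [folklore] -/
theorem relRank_insert_le (M : Matroid α) (C X : Set α) (e : α) :
    M.relRank C (insert e X) ≤ M.relRank C X + 1 :=
  (M ／ C).eRk_insert_le_add_one e X

/-- **Anti-monotonicity in the base** (submodularity): enlarging `C` can only lower the relative
rank. [folklore] -/
theorem relRank_anti_left (M : Matroid α) (X : Set α) (h : C ⊆ D) :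
    M.relRank D X ≤ M.relRank C X := by
  have hMD : M ／ D = M ／ C ／ D := by
    rw [contract_contract, union_eq_self_of_subset_left h]
  rw [relRank, relRank, hMD]
  exact eRk_contract_le _ _ _

/-- Relative rank over `C` and over `M.closure C` agree. [folklore] -/
theorem relRank_closure_left (M : Matroid α) (C X : Set α) :
    M.relRank (M.closure C) X = M.relRank C X := by
  rw [relRank, relRank, contract_closure_eq_contract_delete]
  refine eRk_delete_eq_of_subset_loops (M := M ／ C) ?_ X
  rw [contract_loops_eq]
  exact inter_subset_left

/-- Relative rank over `C` depends on `X` only through `M.closure (X ∪ C)`. [folklore] -/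
theorem relRank_eq_relRank_closure_union (M : Matroid α) (C X : Set α) :
    M.relRank C X = M.relRank C (M.closure (X ∪ C)) := by
  rw [relRank, relRank, ← (M ／ C).eRk_closure_eq X, contract_closure_eq, ← relRank,
    ← relRank, ← relRank_eq_relRank_diff]

/-- If `X ⊆ M.closure (Y ∪ C)` then `relRank C X ≤ relRank C Y`. [folklore] -/
theorem relRank_le_of_subset_closure (M : Matroid α) (C : Set α) (h : X ⊆ M.closure (Y ∪ C)) :
    M.relRank C X ≤ M.relRank C Y := by
  rw [M.relRank_eq_relRank_closure_union C Y]
  exact M.relRank_mono_right C h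

/-- Sets with the same closure over `C` have the same relative rank. [folklore] -/
theorem relRank_congr_closure (M : Matroid α) (C : Set α)
    (h : M.closure (X ∪ C) = M.closure (Y ∪ C)) : M.relRank C X = M.relRank C Y := by
  rw [M.relRank_eq_relRank_closure_union C X, h, ← M.relRank_eq_relRank_closure_union C Y]

/-- Bases with the same closure give the same relative rank. [folklore] -/
theorem relRank_congr_closure_left (M : Matroid α) (X : Set α)
    (h : M.closure C = M.closure D) : M.relRank C X = M.relRank D X := by
  rw [← relRank_closure_left, h, relRank_closure_left]

/-- **Vanishing**: the relative rank of `X` over `C` is zero iff (the ground part of) `X` lies in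
the closure of `C`. [folklore] -/
theorem relRank_eq_zero_iff (M : Matroid α) (C X : Set α) :
    M.relRank C X = 0 ↔ X ∩ M.E ⊆ M.closure C := by
  rw [relRank, eRk_eq_zero_iff', contract_loops_eq, contract_ground]
  constructor
  · intro h x ⟨hxX, hxE⟩
    by_cases hxC : x ∈ C
    · exact M.inter_ground_subset_closure C ⟨hxC, hxE⟩
    · exact (h ⟨hxX, hxE, hxC⟩).1
  · intro h x ⟨hxX, hxE, hxC⟩
    exact ⟨h ⟨hxX, hxE⟩, hxC⟩

/-- Elements of the closure of `C` do not contribute to relative rank over `C`. [folklore] -/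
theorem relRank_eq_zero_of_subset_closure (M : Matroid α) {C X : Set α}
    (h : X ⊆ M.closure C) : M.relRank C X = 0 := by
  rw [relRank_eq_zero_iff]
  exact inter_subset_left.trans h

/-- Inserting an element of `M.closure (X ∪ C)` does not change the relative rank. [folklore] -/
theorem relRank_insert_eq_of_mem_closure (M : Matroid α) {C X : Set α} {e : α}
    (he : e ∈ M.closure (X ∪ C)) : M.relRank C (insert e X) = M.relRank C X := by
  rw [relRank_eq_relRank_closure_union, insert_union, closure_insert_eq_of_mem_closure he,
    ← relRank_eq_relRank_closure_union]

/-- Inserting an element raises the relative rank by exactly one unless it lies in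
`M.closure (X ∪ C)` (for an element of the ground set). [folklore] -/
theorem relRank_insert_eq_add_one (M : Matroid α) {C X : Set α} {e : α} (heE : e ∈ M.E)
    (he : e ∉ M.closure (X ∪ C)) : M.relRank C (insert e X) = M.relRank C X + 1 := by
  rw [relRank, relRank]
  apply eRk_insert_eq_add_one
  rw [contract_ground, contract_closure_eq]
  refine ⟨⟨heE, fun heC => he ?_⟩, fun h => he h.1⟩
  exact M.mem_closure_of_mem' (Or.inr heC) heE

/-! ### The addition formula -/

/-- **Addition formula** for relative rank along `C ⊆ D ⊆ X`:
`relRank C D + relRank D X = relRank C X` (Oxley §3.3 in the finite case). [folklore] -/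
theorem relRank_add_relRank (M : Matroid α) (hCD : C ⊆ D) (hDX : D ⊆ X) :
    M.relRank C D + M.relRank D X = M.relRank C X := by
  set N := M ／ C with hN
  have hMD : M ／ D = N ／ D := by
    rw [hN, contract_contract, union_eq_self_of_subset_left hCD]
  rw [relRank, relRank, relRank, hMD, ← hN]
  obtain ⟨J, hJ⟩ := N.exists_isBasis' D
  obtain ⟨K, hK, hJK⟩ := hJ.indep.subset_isBasis'_of_subset (hJ.subset.trans hDX)
  -- `N ／ D` is `N ／ J` with some loops deleted
  have hloops : (D \ J) ∩ (N ／ J).E ⊆ (N ／ J).loops := by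
    rintro x ⟨⟨hxD, hxJ⟩, hxE⟩
    rw [contract_loops_eq]
    refine ⟨?_, hxJ⟩
    rw [hJ.closure_eq_closure]
    rw [contract_ground] at hxE
    exact N.inter_ground_subset_closure D ⟨hxD, hxE.1⟩
  have hrk : (N ／ D).eRk X = (N ／ J).eRk X := by
    rw [hJ.contract_eq_contract_delete]
    exact eRk_delete_eq_of_subset_loops hloops X
  have hKJ : (N ／ J).IsBasis' (K \ J) X := hK.contract_isBasis'_sdiff_of_subset hJK
  rw [hrk, ← hJ.encard_eq_eRk, ← hK.encard_eq_eRk, ← hKJ.encard_eq_eRk, add_comm]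
  exact encard_sdiff_add_encard_of_subset hJK

/-- Addition formula, general form: for `C ⊆ D`,
`relRank C D + relRank D X = relRank C (D ∪ X)`. [folklore] -/
theorem relRank_add_relRank' (M : Matroid α) (hCD : C ⊆ D) (X : Set α) :
    M.relRank C D + M.relRank D X = M.relRank C (D ∪ X) := by
  rw [← M.relRank_union_self_left D X]
  exact M.relRank_add_relRank hCD subset_union_left

/-- Monotonicity of relative rank of a fixed set difference: for `C ⊆ D`,
`relRank D X ≤ relRank C (D ∪ X)` with defect `relRank C D`. [folklore] -/
theorem relRank_le_relRank_union_of_subset (M : Matroid α) (hCD : C ⊆ D) (X : Set α) :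
    M.relRank D X ≤ M.relRank C (D ∪ X) := by
  rw [← M.relRank_add_relRank' hCD X]
  exact le_add_self

/-! ### Relative rank and independence -/

/-- A finite set has full relative rank over `C` iff it is independent in the contraction
`M ／ C`. [folklore] -/
theorem relRank_eq_encard_iff_contract_indep (M : Matroid α) (C : Set α) {I : Set α}
    (hI : I.Finite) : M.relRank C I = I.encard ↔ (M ／ C).Indep I := by
  rw [relRank, indep_iff_eRk_eq_encard_of_finite hI]

/-- Independence in the contraction by `C`, in terms of a basis `B` of `C`: `I` is independent
in `M ／ C` iff `I ∪ B` is independent in `M` and `I` is disjoint from `C`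
(`Matroid.IsBasis'.contract_indep_iff`). [folklore] -/
theorem contract_indep_iff_of_isBasis' {B I : Set α} (hB : M.IsBasis' B C) :
    (M ／ C).Indep I ↔ M.Indep (I ∪ B) ∧ Disjoint C I :=
  hB.contract_indep_iff

/-- Full relative rank of a finite set `I` disjoint from `C` over `C`, in terms of a basis `B` of
`C`: `relRank C I = |I|` iff `I ∪ B` is independent. [folklore] -/
theorem relRank_eq_encard_iff_indep_union (M : Matroid α) {B I : Set α} (hB : M.IsBasis' B C)
    (hI : I.Finite) (hdisj : Disjoint C I) : M.relRank C I = I.encard ↔ M.Indep (I ∪ B) := by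
  rw [M.relRank_eq_encard_iff_contract_indep C hI, hB.contract_indep_iff]
  exact and_iff_left hdisj

/-- Relative rank in terms of natural numbers: for finitely many new elements the relative rank
is a natural number bounded by their count. [folklore] -/
theorem relRank_toNat_le_ncard (M : Matroid α) (C X : Set α) (h : (X \ C).Finite) :
    (M.relRank C X).toNat ≤ (X \ C).ncard := by
  have := M.relRank_le_encard_diff C X
  rw [Set.ncard_def]
  exact ENat.toNat_le_toNat this h.encard_lt_top.ne

/-- For finitely many new elements, `relRank` is the coercion of its `toNat`. [folklore] -/
theorem coe_toNat_relRank (M : Matroid α) (C X : Set α) (h : (X \ C).Finite) :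
    ((M.relRank C X).toNat : ℕ∞) = M.relRank C X :=
  ENat.coe_toNat (M.relRank_lt_top_of_finite C h).ne

end Matroid
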